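import Summits.CriticalPhenomena.PercolationContinuityZ3.Theorems.Transplant.SkelFrmQuasiBParamsFaceFloorsClrXA
import Summits.CriticalPhenomena.PercolationContinuityZ3.Theorems.Transplant.SkelFrmBParamsFaceFloorsClrXA
import Summits.CriticalPhenomena.PercolationContinuityZ3.Theorems.Transplant.SkelFrmQuasiBParamsSlotsF
import Summits.CriticalPhenomena.PercolationContinuityZ3.Theorems.Transplant.SkelFrmBParamsSlotsF
import Summits.CriticalPhenomena.PercolationContinuityZ3.Theorems.Transplant.SkelNegBParamsFaceFloorsQYA
import Summits.CriticalPhenomena.PercolationContinuityZ3.Theorems.Transplant.PlanarSkeletonFrmQuasiDefs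
import Summits.CriticalPhenomena.PercolationContinuityZ3.Theorems.Transplant.PlanarSkeletonFrmDefs
import Summits.CriticalPhenomena.PercolationContinuityZ3.Theorems.Transplant.SkelPhiStepIDataNS
import Summits.CriticalPhenomena.PercolationContinuityZ3.Theorems.Transplant.SkelFrmQuasi1ChoiceDefs
import Summits.CriticalPhenomena.PercolationContinuityZ3.Theorems.Transplant.SkelFrmQuasi1ParamsLBL
import Summits.CriticalPhenomena.PercolationContinuityZ3.Theorems.Transplant.SkelFrmQuasi1ParamsPO
import Summits.CriticalPhenomena.PercolationContinuityZ3.Theorems.Transplant.SkelFrmQuasiBChoiceNums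
import Summits.CriticalPhenomena.PercolationContinuityZ3.Theorems.Transplant.SkelFrmQuasiBParamsLF
import Summits.CriticalPhenomena.PercolationContinuityZ3.Theorems.Transplant.SkelFrmQuasiBParamsSchedA
import HarnessLib
import Summits.CriticalPhenomena.PercolationContinuityZ3.Theorems.Transplant.SkelFrmBParamsFaceFloorsQYA
/-!
# GEN-Q PORT (WAVE-Q table v0.8 section 2, row G188, U-level L19; captain R-6/R-7 2026-08-27: carrier token swap `PlanarSkeletonFrmFrom ↦ PlanarSkeletonFrmQuasi`)
# of the tree module «Transplant/SkelFrmFromBParamsFaceFloorsQYA» (sha256 5e8ae92c5f4be7ea…) onto the quasi-step carrier `PlanarSkeletonFrmQuasi` (p507026): «SkelFrmQuasiBParamsFaceFloorsQYA»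

HAND HUNK (L-FLOORMAP-1 ①⑥ / L-KitS-1 reader side; G017 «SkelFrmQuasiBChoiceNums», hp-8's KitSN): KS0.R'0→KS0.R'0N×5 — the kit of record at window cost `KS.NQ Φ`.

ORIGINAL TITLE: (F) VALUE LAYER, N2 twin (hp-8 g42, 2026-08-23; F-DISCHARGE-MAP-N2 G18 y′-run width floor `hW`): `port_frm.py` text of N1 `SkelNegBParamsFaceFloorsQYA` (hp-8 g36)

builds on p205010 (kernel theorem, internal audit signed; external expert review pending) — nothing in this file uses p205010; NOTHING is claimed about any open node
((N3-b), the end state).  Lane `prim-bschramm`, seat `prim-bschramm-stmt` (gen 33; GEN-Q column pen; tool = captain gen-1 g4's port_genq.py R-14 --cone + p3-g30's T1 patch).  Helper file (`--supports stmt-CriticalPhenomena-4575 --as helper`).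
PORT RULES (U-wave r1–r4 re-used, GEN-Q hunk classes of p3-g29 #6136): declaration order, names and proof texts are those of «SkelFrmFromBParamsFaceFloorsQYA», byte-identical except
(i) the carrier token `PlanarSkeletonFrmFrom ↦ PlanarSkeletonFrmQuasi` in binders, `namespace`/`end` lines and qualified names (module names `SkelFrmFrom… ↦ SkelFrmQuasi…`
in imports of already-ported rows); (ii) `Φ.step ↦ Φ.qstep` with the called Steps lemma replaced by its `…Q`/`_q` twin and the cost `Φ.M` threaded (none in this file unless
listed below); (iii) `Φ.cyl_connected ↦ Φ.cyl_reach` readers (none unless listed); (iv) graph-ball radii / window floors ×`Φ.M` (none unless listed).  Carrier-free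
residents stay imported/exported from the original «SkelFrmBParamsFaceFloorsQYA» exactly as in the FrmFrom port.  Docstrings and citations are the original's.

-/

noncomputable section

open scoped Classical

namespace Summit.CriticalPhenomena.PercolationContinuityZ3.Theorems.Transplant

namespace PlanarSkeletonFrmQuasi

namespace NegB

open Literature.Probability.Percolation Literature.Probability.LatticeModels SimpleGraph
open SkelConc (Consts)
open Skelφ (shearUnit)
open Skelφ.StepI (DataN)
open Neg

namespace KS

export PlanarSkeletonNeg.NegB.KS (ediv_step_le_two)

section WidthY

-- GEN-Q (R-2, captain 2026-08-27): `PlanarSkeletonFrmFrom.NegB.KS.hW_YA` is not in the used cone of the node top — not ported.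

end WidthY

section WidthY2

set_option maxHeartbeats 800000 in
/-- **M3′ y′-face field `hW`, SERVED FORM** (stmt-g17 10:05:23Z: the y′ landing half-height `qB′ := qBF` is `≈ n_Lℓ_L/(2U)`, so `hW_YA`'s
`qB ≤ 1000Kq(RA′+2)` is not dischargeable; this twin takes instead the budget `2·(U·qB) ≤ n_L·ℓ_L + n_L·(21·S_F + 22·RA′ + 130)` (= stmt's
`KS.two_U_qBF_le` at `qB := qBF`) and the floor `64·S_F ≤ M_L` (`KS.ML_floorsA….2.2.1`)). [cite: KozmaNitzan2024, §4 Lemma 12 (pp. 23–25)] -/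
theorem hW_YA₂ (κ : Consts) {V : Type} [DecidableEq V] [Countable V] {G : SimpleGraph V} [G.LocallyFinite] (Φ : PlanarSkeletonFrmQuasi G) (t : V) (p : unitInterval) (D : Skelφ.StepI.DataNS V) (c : ℕ) (mk : ℕ) (g : ℕ) (f : ℕ) (hN : EqNumL κ Φ t p D g f) (hκ : (hL κ Φ t p D g f).natAbs ≤ 10 * nL κ Φ t p D g f)
    (hℓA : 22000 * Neg.Kq κ * (KS0.R'0N κ Φ (KS.NQ Φ) t p D mk + 2) ≤ ℓL κ Φ t p D g f) (hS64 : 64 * SF κ Φ t p D c mk ≤ ML κ Φ t p D g) {Nr qB : ℕ}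
    (hNr : Nr + 1 ≤ 600 * Neg.Kq κ)
    (hqB2 : 2 * ((shearUnit (nL κ Φ t p D g f) (hL κ Φ t p D g f) : ℤ) * qB) ≤ ((nL κ Φ t p D g f) : ℤ) * (ℓL κ Φ t p D g f) + ((nL κ Φ t p D g f) : ℤ) * (21 * (SF κ Φ t p D c mk : ℤ) + 22 * (KS0.R'0N κ Φ (KS.NQ Φ) t p D mk : ℤ) + 130)) :
    ((Nr : ℤ) + 1) * ((((nL κ Φ t p D g f) : ℤ) * (ℓL κ Φ t p D g f) / (shearUnit (nL κ Φ t p D g f) (prFA κ Φ t p D g f).h : ℕ) + 1) - (((nL κ Φ t p D g f) : ℤ) * (ℓL κ Φ t p D g f) - (shearUnit (nL κ Φ t p D g f) (prFA κ Φ t p D g f).h : ℕ) + 1) / (shearUnit (nL κ Φ t p D g f) (prFA κ Φ t p D g f).h : ℕ)) + qB +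
        ((Nr : ℤ) + 1) * (KS0.R'0N κ Φ (KS.NQ Φ) t p D mk) + 2 ≤ (((nL κ Φ t p D g f) * (ℓL κ Φ t p D g f) / shearUnit (nL κ Φ t p D g f) (prFA κ Φ t p D g f).h + 1 : ℕ) : ℤ) := by
  obtain ⟨hn1, hℓ1⟩ := one_le_of_eqNumL κ Φ t p D g f hN
  obtain ⟨hU1, hU2⟩ := clr_shearUnit_bounds κ Φ t p D g f hκ
  have hMℓ := hN.ℓ_le
  have hh : (prFA κ Φ t p D g f).h = hL κ Φ t p D g f := rfl
  rw [hh]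
  have hn : (1 : ℤ) ≤ ((nL κ Φ t p D g f) : ℤ) := by exact_mod_cast hn1
  have hNr' : (Nr : ℤ) + 1 ≤ 600 * (Neg.Kq κ : ℤ) := by exact_mod_cast hNr
  have hℓ' : 22000 * (Neg.Kq κ : ℤ) * ((KS0.R'0N κ Φ (KS.NQ Φ) t p D mk : ℤ) + 2) ≤ ((ℓL κ Φ t p D g f) : ℤ) := by exact_mod_cast hℓA
  have hS' : 64 * (SF κ Φ t p D c mk : ℤ) ≤ (ML κ Φ t p D g : ℤ) := by exact_mod_cast hS64
  set Uz : ℤ := (shearUnit (nL κ Φ t p D g f) (hL κ Φ t p D g f) : ℤ) with hUdef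
  set n : ℤ := ((nL κ Φ t p D g f) : ℤ)
  set ℓ : ℤ := ((ℓL κ Φ t p D g f) : ℤ)
  set S : ℤ := (SF κ Φ t p D c mk : ℤ)
  set R : ℤ := (KS0.R'0N κ Φ (KS.NQ Φ) t p D mk : ℤ)
  have hUpos : 0 < Uz := by linarith
  have hstep := ediv_step_le_two (n * ℓ) hUpos
  have hq1 : (1 : ℤ) ≤ Neg.Kq κ := by exact_mod_cast Neg.one_le_Kq κ
  have hR0 : (0 : ℤ) ≤ R := Nat.cast_nonneg _
  have hS0 : (0 : ℤ) ≤ S := Nat.cast_nonneg _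
  have hNr0 : (0 : ℤ) ≤ (Nr : ℤ) := Nat.cast_nonneg _
  have hq0 : (0 : ℤ) ≤ (qB : ℤ) := Nat.cast_nonneg _
  -- `U·W ≥ nℓ` for `W = ⌊nℓ/U⌋ + 1`
  have ecast : (((nL κ Φ t p D g f) * (ℓL κ Φ t p D g f) / shearUnit (nL κ Φ t p D g f) (hL κ Φ t p D g f) + 1 : ℕ) : ℤ) = n * ℓ / Uz + 1 := by push_cast; rfl
  rw [ecast]
  obtain ⟨f1, f2⟩ := PlanarSkeletonNeg.NegB.RootArith.floor_sandwich (x := n * ℓ) (d := Uz) hUpos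
  have hd0 : 0 ≤ n * ℓ / Uz + 1 - (n * ℓ - Uz + 1) / Uz := by
    have : (n * ℓ - Uz + 1) / Uz ≤ n * ℓ / Uz := Int.ediv_le_ediv hUpos (by linarith)
    linarith
  -- it suffices that `U·LHS ≤ U·W`; we bound `U·LHS ≤ nℓ < U·W`
  have h1 : ((Nr : ℤ) + 1) * (n * ℓ / Uz + 1 - (n * ℓ - Uz + 1) / Uz) ≤ 2 * ((Nr : ℤ) + 1) := by nlinarith
  have key : Uz * (2 * ((Nr : ℤ) + 1) + (qB : ℤ) + ((Nr : ℤ) + 1) * R + 2) ≤ n * ℓ := by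
    have a : Uz * (2 * ((Nr : ℤ) + 1) + ((Nr : ℤ) + 1) * R + 2) ≤ 11 * n * (((Nr : ℤ) + 1) * (R + 2) + 2) := by
      have : 2 * ((Nr : ℤ) + 1) + ((Nr : ℤ) + 1) * R + 2 = ((Nr : ℤ) + 1) * (R + 2) + 2 := by ring
      rw [this]; exact mul_le_mul_of_nonneg_right hU2 (by positivity)
    have b : ((Nr : ℤ) + 1) * (R + 2) ≤ 600 * (Neg.Kq κ : ℤ) * (R + 2) := mul_le_mul_of_nonneg_right hNr' (by linarith)
    have b' : 11 * n * (((Nr : ℤ) + 1) * (R + 2) + 2) ≤ 11 * n * (600 * (Neg.Kq κ : ℤ) * (R + 2) + 2) :=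
      mul_le_mul_of_nonneg_left (by linarith) (by linarith)
    have hMℓ' : (ML κ Φ t p D g : ℤ) + 1 ≤ ℓ := by exact_mod_cast hMℓ
    have i1 : 63 * S ≤ ℓ := by linarith
    have hKR : R + 2 ≤ (Neg.Kq κ : ℤ) * (R + 2) := by nlinarith
    have i2 : 3 * (13200 * (Neg.Kq κ : ℤ) * (R + 2) + 22 * R + 174) ≤ 2 * ℓ := by nlinarith
    have i3 : 13200 * (Neg.Kq κ : ℤ) * (R + 2) + 44 + 21 * S + 22 * R + 130 ≤ ℓ := by linarith
    have c2 : n * (13200 * (Neg.Kq κ : ℤ) * (R + 2) + 44 + 21 * S + 22 * R + 130) ≤ n * ℓ := mul_le_mul_of_nonneg_left i3 (by linarith)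
    have e : Uz * (2 * ((Nr : ℤ) + 1) + (qB : ℤ) + ((Nr : ℤ) + 1) * R + 2) = Uz * (qB : ℤ) + Uz * (2 * ((Nr : ℤ) + 1) + ((Nr : ℤ) + 1) * R + 2) := by ring
    rw [e]
    linarith
  -- conclude: `U·LHS ≤ nℓ < U·W`
  have h2 : Uz * (((Nr : ℤ) + 1) * (n * ℓ / Uz + 1 - (n * ℓ - Uz + 1) / Uz) + (qB : ℤ) + ((Nr : ℤ) + 1) * R + 2) ≤
      Uz * (2 * ((Nr : ℤ) + 1) + (qB : ℤ) + ((Nr : ℤ) + 1) * R + 2) := mul_le_mul_of_nonneg_left (by linarith) hUpos.le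
  have eW : Uz * (n * ℓ / Uz + 1) = Uz * (n * ℓ / Uz) + Uz := by ring
  have h3 : Uz * (((Nr : ℤ) + 1) * (n * ℓ / Uz + 1 - (n * ℓ - Uz + 1) / Uz) + (qB : ℤ) + ((Nr : ℤ) + 1) * R + 2) < Uz * (n * ℓ / Uz + 1) := by
    rw [eW]; linarith
  exact (lt_of_mul_lt_mul_left h3 hUpos.le).le

end WidthY2

end KS

end NegB

end PlanarSkeletonFrmQuasi

end Summit.CriticalPhenomena.PercolationContinuityZ3.Theorems.Transplant

end
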